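import Literature.NumberTheory.LFunctions.Zhang2022.DetectorMainTermFormCS
import Literature.NumberTheory.LFunctions.Zhang2022.DetectorShiftAdmissible
import Literature.NumberTheory.LFunctions.Zhang2022.RepairAdmissibleWide

/-!
# Zhang (2022) §18-margin repair rung, barrier extension (cell landau-siegel §E, slice S-E-p6-1):
# the SHIFT-DETECTOR family — `not_repairable_true_need` in the currency of the detector's own
# main-term form `𝔅_b = Det.FormDet (Det.shiftRecipe b)`, the PSD slot DISPLAYED

Trunk T-ANT (NumberTheory/LFunctions). Y. Zhang, *Discrete mean estimates and the Landau–Siegel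
zero*, arXiv:2211.02515v1 (2022) [Zhang2022LandauSiegel] — **an unrefereed manuscript under
adjudication. WHAT THIS IS NOT: a claim about its Theorems 1–2, about Landau–Siegel zeros, about
Parity, or about a repaired `Margin232`; nothing analytic is asserted. The programme SEARCHES and
TYPES; no claim about Landau–Siegel zeros, Theorems 1–2 of arXiv:2211.02515 or a repaired Margin232
until a kernel theorem says so.**

## What is extended, and in which currency

The §2 endgame of the manuscript (Props. 2.4–2.6 with (2.32)–(2.33), p. 11) needs, at main order, the
joint criterion `C₂₃₂·C₂₃₃ < |𝔡+𝔡′|²` («T-true»). The verdict of record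
`RepairVerdictAssembly.not_repairable_true_need` (family `familyR` of `RepairRplus.Rplus`) decides it for
the PRINTED zero-detector `𝔠*(ρ,ψ) = −iM(ρ+β₁)M(ρ+β₂)M(ρ+β₃)/M′(ρ)`, shift multiples `b = (1,2,3)`
((2.13)), whose formula-I main-term form is the tree's `𝔅` (`Det.FormDet_zhang`,
`Det.shiftRecipe_std`). This file adds the DETECTOR COORDINATE for the three-shift family
`𝔠*_b = −iΠ_jM(ρ+ib_jα)/M′(ρ)` (registry rows E-010 «E*-S», E-015; LEVERS L8; OBJECTIVE §1.3 (O4)):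

* the detector coordinate is the SIGN-ADMISSIBLE shift box `Det.SignAdmissible b` of
  `DetectorShiftAdmissible` (the B-det typer's predicate, cited not re-typed): exactly the shape the PROOF
  of Lemma 2.3 uses (p. 6: `M(ρ+β₂)M(ρ+β₃) > 0`, both upper shifts in ONE zero-free gap `[k, k+1]` of the
  `α`-lattice of Prop. 2.2 (iii); `M(ρ+β₁)/(iM′(ρ)) ≥ 0`, the first shift `b₀ ≤ 1` below the first lattice
  zero), sorted and pairwise distinct (its declared narrowing), endpoints CLOSED — the lattice limits
  `b₀ → 1⁻`, `b₁ → k⁺`, `b₂ → (k+1)⁻` of the cell's derivation note are realised by the correction factors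
  `(1 ∓ c′α𝓛)` of (2.13), invisible at main order, so the printed `(1,2,3)` is a member
  (`Det.signAdmissible_std`) — together with the Part-III contour cap `Det.InShiftBox b` (`0 < b_j < 5`).
  Two more members typed here: `bOffLattice = (1/2; 23/10, 27/10)`, `bNearLattice = (999/1000; 2001/1000,
  2999/1000)`; the cell's indefinite control `(3/2; 5/2, 7/2)` is outside (`Det.not_signAdmissible_threeHalves`).
* `Repair.DetShiftDesign` — a design: a shift triple `b` and the two LEGS `(u, f)` of a cross mean (the
  `H`-side profile and the probe), ONE-SIDED kinked profiles on `[0,1]` vanishing at the top (support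
  `< P`, `g(1) = 0`: the range (7.2) of Prop. 7.1, on which formula I IS the main term). Class predicate
  `DetShiftDesign.InClass` = `SignAdmissible b ∧ InShiftBox b ∧` both legs one-sided kinked (the det class
  text (i)+(iii) of the cell's B-det/REF.md F-det-8 (a); (ii) «coefficient class» is descriptive text; (iv)
  «weight `≥ 0` on the sampled zeros, one structure, CS/POS endgame» is the (B1)/(B2) reading ALREADY
  DECIDED in tree by `Det.norm_sq_discreteForm_le` / `Det.not_mainOrder_closing` (p456255) — cited).
* `DetShiftDesign.Verdict` — E*-slot **`Det.FormDetPSD (Det.shiftRecipe b)` DISPLAYED** (bare `Prop`, kind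
  (c), registry E-010 second half; NOT asserted for any `b ≠ (1,2,3)`) `→ ¬ (𝔅_b(u)·𝔅_b(f) < ‖P_b(u,f)‖²)`,
  `𝔅_b = Det.FormDet (shiftRecipe b)`, `P_b = Det.FormDetPolar (shiftRecipe b)`.
  **`not_repairable_detShift : ∀ d, d.InClass → d.Verdict`** is `Det.not_trueNeed_of_psd` (p457273: PSD ⇒
  polarisation ⇒ exact Cauchy–Schwarz, any recipe); `familyDetShift`, `familyDetShift_decided`,
  `rplus_detShift_decided : ClassDecided (Rplus ++ [familyDetShift])` (extension protocol of `RepairRplus`).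
* C2: at `b = (1,2,3)` the slot is DISCHARGED (`Det.formDetPSD_shiftRecipe_std`) and the verdict IS
  `familyH1`'s `¬ (𝔅(u)𝔅(f) < ‖P(u,f)‖²)` on the same legs (`detShift_std_verdict_iff`, `detShift_std_toH1`).
* C4: the GENUINE one-sided legs of every
  `θ` of the calculus class `Repair.AdmissibleThetaCalc` (p456882) are members — the `𝔡`-block legs
  `(g₁, f) = (h1Profile θ, tentT θ)` (`dLeg`) and the `𝔡′`-block legs `(f₂, g₂) = (tentT θ.reflectJ,
  h2Profile θ)` (`dPrimeLeg`) of (10.1) — and at `b = (1,2,3)` their `FormDet` triples are the record's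
  `(Re 𝔠₁T, C233T, dSum1S)`, `(C233T θ.reflectJ, Re 𝔠₂T, dSum2S)`, so the verdict there reads
  `¬ (Re 𝔠₁T·C233T < |𝔡|²)`, `¬ (C233T(θ.reflectJ)·Re 𝔠₂T < |𝔡′|²)` (`detShift_std_dLeg_verdict`, `…dPrimeLeg…`).

## Currency line (C3(e)) and what is NOT claimed

(1) FormDet currency: the theorems are about the continued formula-I calculus `Det.FormDet (shiftRecipe b)`
of the CANDIDATE recipe `Det.shiftRecipe` (weights `Det.shiftW`, derivation in-house: registry E-010 first
half); that the three main-order constants of a detector-`b` design ARE this triple is registry item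
E-det-main (`DetectorTemplate.Detector.MeanEval`, p456292) — open off `b = (1,2,3)`, not claimed here.
(2) The slot `FormDetPSD (shiftRecipe b)` is CONJECTURE-SHAPED for `b ≠ (1,2,3)`; the cell's certified
eigen-scans (kit j256305, j256596, j256588, j256776: every admissible cell of nonneg type, non-admissible
controls indefinite) are numerical EVIDENCE, not a proof and not a hypothesis discharge. (3) The GLUED
design level is NOT in this family: the `H`-side of a class-`R` design is the two-sided profile
`𝔤_θ = g₁ + R̃g₂` (`𝔤_θ(1) = conj b₀ ≠ 0`), outside the one-sided class on which formula I is the main term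
and on which the slot speaks; its joint verdict needs the recipe's two-sided PSD extension (formula II +
window terms for general `b`; `DetectorGlueForm` types the glue block only, «derivation OPEN») and is, at
`b = (1,2,3)`, exactly `Repair.not_repairable_true_need_calc` (`familyRCalc`, K-S2) — cited, not re-proved,
not extended. (4) Nothing here is a statement about zeros. Elementary assembly over landed calculus; no
numerics; no new `Prop` facts; standard axioms.

References: Y. Zhang, arXiv:2211.02515v1 (2022), §2 (2.10)–(2.13), Lemma 2.3 and its proof, Props. 2.2,
2.4–2.6, (2.16)–(2.19), (2.32)–(2.33) [p. 5–6, 10–11]; §7 Prop. 7.1, (7.2), (7.19)–(7.21) [p. 44]; §8 (8.23);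
§9 (9.7); §10 (10.1), (10.12)–(10.17). [cite: Zhang2022LandauSiegel, §§2, 7–10] -/

noncomputable section

open Real Complex ComplexConjugate

namespace Literature.NumberTheory.LFunctions.Zhang2022

/-! ### Two more members of the shift box (the detector coordinate of the class is non-trivial) -/

namespace Det

/-- An admissible triple OFF the lattice: `(1/2; 23/10, 27/10)` (pair in the gap `k = 2`).
[cite: Zhang2022LandauSiegel, §2 (2.13), Lemma 2.3] -/
def bOffLattice : Fin 3 → ℝ := ![1 / 2, 23 / 10, 27 / 10]

/-- An admissible triple NEAR the printed lattice point: `(999/1000; 2001/1000, 2999/1000)` (`k = 2`).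
[cite: Zhang2022LandauSiegel, §2 (2.13), Lemma 2.3] -/
def bNearLattice : Fin 3 → ℝ := ![999 / 1000, 2001 / 1000, 2999 / 1000]

/-- `bOffLattice` is sign-admissible (`Det.SignAdmissible`, p-typed by the B-det typer) and in the Part-III box.
[cite: Zhang2022LandauSiegel, §2 (2.13), Lemma 2.3; §14 (14.2)] -/
theorem signAdmissible_bOffLattice : SignAdmissible bOffLattice ∧ InShiftBox bOffLattice := by
  refine ⟨⟨?_, ?_, ?_, ?_, 2, ?_, ?_⟩, fun j => ?_⟩ <;> (try fin_cases j) <;>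
    norm_num [bOffLattice, Matrix.cons_val_two, Matrix.tail_cons, Matrix.head_cons]

/-- `bNearLattice` is sign-admissible and in the Part-III box. [cite: Zhang2022LandauSiegel, §2 (2.13), Lemma 2.3; §14 (14.2)] -/
theorem signAdmissible_bNearLattice : SignAdmissible bNearLattice ∧ InShiftBox bNearLattice := by
  refine ⟨⟨?_, ?_, ?_, ?_, 2, ?_, ?_⟩, fun j => ?_⟩ <;> (try fin_cases j) <;>
    norm_num [bNearLattice, Matrix.cons_val_two, Matrix.tail_cons, Matrix.head_cons]

/-- Both witnesses are off the printed triple. [cite: Zhang2022LandauSiegel, §2 (2.13)] -/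
theorem bOffLattice_ne_std : bOffLattice ≠ ![1, 2, 3] ∧ bNearLattice ≠ ![1, 2, 3] := by
  refine ⟨fun h => ?_, fun h => ?_⟩
  · have h0 := congr_fun h 0
    norm_num [bOffLattice] at h0
  · have h0 := congr_fun h 0
    norm_num [bNearLattice] at h0

end Det

namespace Repair

open Det

/-! ### The family: designs, class predicate, verdict with the PSD slot displayed -/

/-- **A design of the shift-detector family**: a shift triple `b` (detector `𝔠*_b = −iΠ_jM(ρ+ib_jα)/M′(ρ)`)
and the two legs of a cross mean it is run against — the `H`-side profile `u` and the probe `f` with their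
right derivatives (profiles of `y = log n/log P` on `[0,1]`). [cite: Zhang2022LandauSiegel, §2 (2.13), (2.16)–(2.18); §7 (7.2) p.44] -/
structure DetShiftDesign : Type where
  /-- shift multiples `b = (b₀; b₁, b₂)` of the detector -/
  b : Fin 3 → ℝ
  /-- the `H`-side leg -/
  u : ℝ → ℂ
  /-- its right derivative -/
  u' : ℝ → ℂ
  /-- the probe leg -/
  f : ℝ → ℂ
  /-- its right derivative -/
  f' : ℝ → ℂ

namespace DetShiftDesign

/-- **Class membership** (NO analytic hypothesis inside): `b` sign-admissible (`Det.SignAdmissible`, the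
Lemma-2.3 shape) and inside the Part-III contour (`Det.InShiftBox`, `0 < b_j < 5`); both legs ONE-SIDED
kinked profiles on `[0,1]` vanishing at the top, `u(1) = f(1) = 0` — the range (7.2) of Prop. 7.1, on which
formula I is the main term. [cite: Zhang2022LandauSiegel, §2 (2.13), Lemma 2.3; §7 Prop. 7.1, (7.2) p.44] -/
def InClass (d : DetShiftDesign) : Prop :=
  SignAdmissible d.b ∧ InShiftBox d.b ∧
    KinkedProfile d.u d.u' ∧ d.u 1 = 0 ∧ KinkedProfile d.f d.f' ∧ d.f 1 = 0

/-- **The verdict «no closing at main order», E*-slot displayed**: IF the detector's formula-I form is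
positive semidefinite on the one-sided class (`Det.FormDetPSD (shiftRecipe b)`, bare `Prop`, kind (c),
registry E-010 — NOT asserted), THEN the joint criterion fails for its own form and polar form:
`¬ (𝔅_b(u)·𝔅_b(f) < ‖P_b(u,f)‖²)`. [cite: Zhang2022LandauSiegel, §2 (2.18), Props. 2.4–2.6, (2.32)–(2.33)] -/
def Verdict (d : DetShiftDesign) : Prop :=
  FormDetPSD (shiftRecipe d.b) →
    ¬ (FormDet (shiftRecipe d.b) d.u d.u' * FormDet (shiftRecipe d.b) d.f d.f'
        < ‖FormDetPolar (shiftRecipe d.b) d.u d.u' d.f d.f'‖ ^ 2)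

end DetShiftDesign

/-- **NOT REPAIRABLE BY A SIGN-ADMISSIBLE SHIFT DETECTOR (FormDet currency, PSD slot displayed).** For
every design of the family — any admissible `b`, any one-sided kinked legs `u`, `f` — `FormDetPSD
(shiftRecipe b)` implies `¬ (𝔅_b(u)·𝔅_b(f) < ‖P_b(u,f)‖²)`: positive semidefiniteness, the polarisation
identity of the recipe form (`Det.formDet_add_smul`) and the discriminant give exact Cauchy–Schwarz
(`Det.not_trueNeed_of_psd`). A statement about the method's main terms; nothing about zeros.
[cite: Zhang2022LandauSiegel, §2 (2.18), Props. 2.4–2.6, (2.32)–(2.33); §7 Prop. 7.1 p.44] -/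
theorem not_repairable_detShift : ∀ d : DetShiftDesign, d.InClass → d.Verdict :=
  fun _ ⟨_, _, hu, hu1, hf, hf1⟩ hpsd => not_trueNeed_of_psd hpsd hu hf hu1 hf1

/-- the Cauchy–Schwarz inequality itself on the class, under the slot: `‖P_b(u,f)‖² ≤ 𝔅_b(u)·𝔅_b(f)`.
[cite: Zhang2022LandauSiegel, §2 after (2.33)] -/
theorem normSq_le_detShift (d : DetShiftDesign) (h : d.InClass) (hpsd : FormDetPSD (shiftRecipe d.b)) :
    ‖FormDetPolar (shiftRecipe d.b) d.u d.u' d.f d.f'‖ ^ 2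
      ≤ FormDet (shiftRecipe d.b) d.u d.u' * FormDet (shiftRecipe d.b) d.f d.f' :=
  norm_sq_formDetPolar_le_of_psd hpsd h.2.2.1 h.2.2.2.2.1 h.2.2.2.1 h.2.2.2.2.2

/-- the threshold shape of the §2 final step on the class, under the slot: bounds `𝔅_b(u) ≤ q` ((2.32)-type),
`𝔅_b(f) ≤ c_J` ((2.33)-type), `dd ≤ ‖P_b(u,f)‖` (Prop. 2.4-type) never give `√(q·c_J) < dd`
(`Det.not_closing_of_psd`). [cite: Zhang2022LandauSiegel, §2 (2.18), Props. 2.4–2.6 p.6, (2.32)–(2.33)] -/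
theorem not_sqrt_closing_detShift (d : DetShiftDesign) (h : d.InClass)
    (hpsd : FormDetPSD (shiftRecipe d.b)) {q cJ dd : ℝ} (hq : FormDet (shiftRecipe d.b) d.u d.u' ≤ q)
    (hcJ : FormDet (shiftRecipe d.b) d.f d.f' ≤ cJ) (hd : dd ≤ ‖FormDetPolar (shiftRecipe d.b) d.u d.u' d.f d.f'‖) :
    ¬ (Real.sqrt (q * cJ) < dd) :=
  not_closing_of_psd hpsd h.2.2.1 h.2.2.2.2.1 h.2.2.2.1 h.2.2.2.2.2 hq hcJ hd

/-! ### Extension protocol of `RepairRplus` -/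

/-- family «sign-admissible shift detector, one-sided legs, FormDet currency» (E*-slot `FormDetPSD` displayed
in the verdict, nothing conditional in the class). [cite: Zhang2022LandauSiegel, §2 Lemma 2.3, (2.32)–(2.33)] -/
def familyDetShift : DesignFamily where
  Design := DetShiftDesign
  InClass := DetShiftDesign.InClass
  Verdict := DetShiftDesign.Verdict

/-- `familyDetShift` is decided. [cite: Zhang2022LandauSiegel, §2 (2.32)–(2.33)] -/
theorem familyDetShift_decided : familyDetShift.Decided := not_repairable_detShift

/-- **`R⁺ ++ [familyDetShift]` is decided** (`RepairRplus.rplus_extend`). [cite: Zhang2022LandauSiegel, §2 (2.32)–(2.33)] -/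
theorem rplus_detShift_decided : ClassDecided (Rplus ++ [familyDetShift]) :=
  rplus_extend familyDetShift_decided

/-! ### C2: at the printed triple the slot is discharged and the verdict is `familyH1`'s -/

section Std

variable {u u' f f' : ℝ → ℂ}

/-- At `b = (1,2,3)` the detector form is the tree's `𝔅` on one-sided kinked profiles
(`Det.shiftRecipe_std`, `Det.FormDet_zhang`). [cite: Zhang2022LandauSiegel, Prop 7.1 with (8.11)–(8.23), pp.44–50] -/
theorem formDet_std_eq (hu : KinkedProfile u u') (hu1 : u 1 = 0) :
    FormDet (shiftRecipe ![1, 2, 3]) u u' = mainTermForm u u' := by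
  rw [shiftRecipe_std]; exact FormDet_zhang hu hu1

/-- … and its polar form is the tree's `P` (`Det.FormDetPolar_zhang`). [cite: Zhang2022LandauSiegel, Prop 7.1 with (8.11)–(8.23), pp.44–50] -/
theorem formDetPolar_std_eq (hu : KinkedProfile u u') (hf : KinkedProfile f f') (hu1 : u 1 = 0)
    (hf1 : f 1 = 0) : FormDetPolar (shiftRecipe ![1, 2, 3]) u u' f f' = mainTermFormPolar u u' f f' := by
  rw [shiftRecipe_std]; exact FormDetPolar_zhang hu hf hu1 hf1

/-- **C2.** At `b = (1,2,3)` the slot holds (`Det.formDetPSD_shiftRecipe_std`) and the family's verdict on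
one-sided kinked legs is LITERALLY the profile-level verdict of `R̄` (`RepairRplus.familyH1`):
`¬ (𝔅(u)𝔅(f) < ‖P(u,f)‖²)`. [cite: Zhang2022LandauSiegel, §2 (2.18), (2.32)–(2.33)] -/
theorem detShift_std_verdict_iff (hu : KinkedProfile u u') (hf : KinkedProfile f f') (hu1 : u 1 = 0)
    (hf1 : f 1 = 0) :
    (⟨![1, 2, 3], u, u', f, f'⟩ : DetShiftDesign).Verdict ↔
      ¬ (mainTermForm u u' * mainTermForm f f' < ‖mainTermFormPolar u u' f f'‖ ^ 2) := by
  simp only [DetShiftDesign.Verdict, formDet_std_eq hu hu1, formDet_std_eq hf hf1,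
    formDetPolar_std_eq hu hf hu1 hf1]
  exact ⟨fun h => h formDetPSD_shiftRecipe_std, fun h _ => h⟩

/-- **C2 at family level**: a member with `b = (1,2,3)` is a `familyH1` member (kinked ⇒ `H¹`) with the
same verdict. [cite: Zhang2022LandauSiegel, §2 (2.18), (2.32)–(2.33)] -/
theorem detShift_std_toH1 (d : DetShiftDesign) (h : d.InClass) (hb : d.b = ![1, 2, 3]) :
    familyH1.InClass (d.u, d.u', d.f, d.f') ∧ (d.Verdict ↔ familyH1.Verdict (d.u, d.u', d.f, d.f')) := by
  obtain ⟨b, u, u', f, f'⟩ := d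
  obtain ⟨-, -, hu, hu1, hf, hf1⟩ := h
  simp only at hb hu hu1 hf hf1
  subst hb
  exact ⟨⟨hu.isH1, hf.isH1⟩, detShift_std_verdict_iff hu hf hu1 hf1⟩

end Std

/-! ### C4: the genuine design legs of a calculus-class `θ` are members; the dictionary at `b = (1,2,3)` -/

section Legs

variable {θ : Theta} {b : Fin 3 → ℝ}

/-- `g₁(1) = 0` on `R_calc` (`ϰ(ν,k)(1) = 0` for `0 < ν ≤ 1`). [cite: Zhang2022LandauSiegel, (2.23), (2.27)] -/
theorem h1Profile_one_calc (h : AdmissibleThetaCalc θ) : h1Profile θ 1 = 0 := by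
  obtain ⟨h3, h32, h21, h1, -, -, -⟩ := h
  unfold h1Profile pairProfile
  rw [kappaP_one (by linarith) h1, kappaP_one (by linarith) (h21.le.trans h1)]; ring

/-- `g₂(1) = 0` on `R_calc`. [cite: Zhang2022LandauSiegel, (2.25), (2.27)] -/
theorem h2Profile_one_calc (h : AdmissibleThetaCalc θ) : h2Profile θ 1 = 0 := by
  obtain ⟨h3, h32, h21, h1, -, -, -⟩ := h
  unfold h2Profile pairProfile
  rw [kappaP_one (by linarith) (h21.le.trans h1), kappaP_one h3 (by linarith)]; ring

/-- `f(1) = 0` on `R_calc` (the tent window `[ν₂, ν₁]` has `ν₁ ≤ 1`). [cite: Zhang2022LandauSiegel, (2.28)] -/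
theorem tentT_one_calc (h : AdmissibleThetaCalc θ) : tentT θ 1 = 0 :=
  tentT_of_hi_le h.2.2.1 h.2.2.2.1

/-- `f₂(1) = 0` on `R_calc` (the reflected window `[1−ν₁, 1−ν₂]` has `1 − ν₂ ≤ 1`). [cite: Zhang2022LandauSiegel, (2.30)] -/
theorem rtentT_one_calc (h : AdmissibleThetaCalc θ) : tentT θ.reflectJ 1 = 0 := by
  obtain ⟨h3, h32, h21, -, -, -, -⟩ := h
  exact tentT_of_hi_le (reflectJ_lt h21) (by simp only [reflectJ_nu1]; linarith)

/-- **The `𝔡`-block legs of the design `θ` under detector `b`**: `(u, f) = (g₁, f)` = (`H₁`'s profile,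
`J₁`'s tent) — the pair of (10.12)–(10.13). [cite: Zhang2022LandauSiegel, §10 (10.1), (10.12)–(10.13)] -/
def dLeg (b : Fin 3 → ℝ) (θ : Theta) : DetShiftDesign :=
  ⟨b, h1Profile θ, h1Profile' θ, tentT θ, tentT' θ⟩

/-- **The `𝔡′`-block legs**: `(u, f) = (f₂, g₂)` = (`J₂`'s tent = the tent of `θ.reflectJ`, `H₂`'s
profile) — the pair of (10.14)–(10.16), in the slot order of `Repair.dSum2S`.
[cite: Zhang2022LandauSiegel, §10 (10.1), (10.14)–(10.16)] -/
def dPrimeLeg (b : Fin 3 → ℝ) (θ : Theta) : DetShiftDesign :=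
  ⟨b, tentT θ.reflectJ, tentT' θ.reflectJ, h2Profile θ, h2Profile' θ⟩

/-- **C4 (members): the `𝔡`-block legs of every calculus-class design are in the family** for every
admissible `b`. [cite: Zhang2022LandauSiegel, §2 (2.23), (2.27)–(2.28); §10 (10.1)] -/
theorem inClass_dLeg (hb : SignAdmissible b ∧ InShiftBox b) (hθ : AdmissibleThetaCalc θ) :
    (dLeg b θ).InClass :=
  ⟨hb.1, hb.2, kinkedProfile_h1Profile_calc hθ, h1Profile_one_calc hθ, kinkedProfile_tentT hθ.2.2.1,
    tentT_one_calc hθ⟩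

/-- … and so are the `𝔡′`-block legs. [cite: Zhang2022LandauSiegel, §2 (2.25), (2.27), (2.30); §10 (10.1)] -/
theorem inClass_dPrimeLeg (hb : SignAdmissible b ∧ InShiftBox b) (hθ : AdmissibleThetaCalc θ) :
    (dPrimeLeg b θ).InClass :=
  ⟨hb.1, hb.2, kinkedProfile_tentT (reflectJ_lt hθ.2.2.1), rtentT_one_calc hθ,
    kinkedProfile_h2Profile_calc hθ, h2Profile_one_calc hθ⟩

/-- dictionary at `b = (1,2,3)`: `𝔅_std(g₁) = Re 𝔠₁T(θ)` (K-S1, `frakc1T_eq_mainTermForm_calc`).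
[cite: Zhang2022LandauSiegel, §8 (8.23) p.50] -/
theorem formDet_std_h1Profile (hθ : AdmissibleThetaCalc θ) :
    FormDet (shiftRecipe ![1, 2, 3]) (h1Profile θ) (h1Profile' θ) = (frakc1T θ).re := by
  rw [formDet_std_eq (kinkedProfile_h1Profile_calc hθ) (h1Profile_one_calc hθ),
    frakc1T_eq_mainTermForm_calc hθ, Complex.ofReal_re]

/-- `𝔅_std(g₂) = Re 𝔠₂T(θ)` (K-S1, `frakc2T_eq_mainTermForm_calc`). [cite: Zhang2022LandauSiegel, §9 (9.7) p.52] -/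
theorem formDet_std_h2Profile (hθ : AdmissibleThetaCalc θ) :
    FormDet (shiftRecipe ![1, 2, 3]) (h2Profile θ) (h2Profile' θ) = (frakc2T θ).re := by
  rw [formDet_std_eq (kinkedProfile_h2Profile_calc hθ) (h2Profile_one_calc hθ),
    frakc2T_eq_mainTermForm_calc hθ, Complex.ofReal_re]

/-- `𝔅_std(f) = C233T θ` (K-S1 tent, `h233_on_calc`). [cite: Zhang2022LandauSiegel, §10 (10.19), (2.33)] -/
theorem formDet_std_tentT (hθ : AdmissibleThetaCalc θ) :
    FormDet (shiftRecipe ![1, 2, 3]) (tentT θ) (tentT' θ) = C233T θ := by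
  rw [formDet_std_eq (kinkedProfile_tentT hθ.2.2.1) (tentT_one_calc hθ), h233_on_calc θ hθ]

/-- `𝔅_std(f₂) = C233T (θ.reflectJ)` — the (2.33)-type constant of the reflected window (2.30).
[cite: Zhang2022LandauSiegel, §10 (10.19); (2.30), (2.33)] -/
theorem formDet_std_rtentT (hθ : AdmissibleThetaCalc θ) :
    FormDet (shiftRecipe ![1, 2, 3]) (tentT θ.reflectJ) (tentT' θ.reflectJ) = C233T θ.reflectJ := by
  obtain ⟨h3, h32, h21, h1, -, -, -⟩ := hθ
  rw [formDet_std_eq (kinkedProfile_tentT (reflectJ_lt h21))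
    (tentT_of_hi_le (reflectJ_lt h21) (by simp only [reflectJ_nu1]; linarith))]
  exact mainTermForm_tentT_eq_C233T (reflectJ_lt h21) (by simp only [reflectJ_nu2]; linarith)
    (by simp only [reflectJ_nu1]; linarith)

/-- `P_std(g₁, f) = 𝔡(θ)` (`Repair.dSum1S` IS formula I on these legs: `Det.MformDet_zhang`).
[cite: Zhang2022LandauSiegel, §10 (10.1), (10.12)–(10.13)] -/
theorem formDetPolar_std_dLeg (θ : Theta) :
    FormDetPolar (shiftRecipe ![1, 2, 3]) (h1Profile θ) (h1Profile' θ) (tentT θ) (tentT' θ) = dSum1S θ := by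
  rw [shiftRecipe_std, FormDetPolar, MformDet_zhang, MformDet_zhang]; rfl

/-- `P_std(f₂, g₂) = 𝔡′(θ)` (`Repair.dSum2S` IS formula I on these legs).
[cite: Zhang2022LandauSiegel, §10 (10.1), (10.14)–(10.16)] -/
theorem formDetPolar_std_dPrimeLeg (θ : Theta) :
    FormDetPolar (shiftRecipe ![1, 2, 3]) (tentT θ.reflectJ) (tentT' θ.reflectJ) (h2Profile θ) (h2Profile' θ)
      = dSum2S θ := by
  rw [shiftRecipe_std, FormDetPolar, MformDet_zhang, MformDet_zhang]; rfl

/-- **The family's verdict at `(b, θ) = ((1,2,3), θ)`, `𝔡`-block, in the record's functionals**: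
`¬ (Re 𝔠₁T(θ) · C233T(θ) < |𝔡(θ)|²)` for every calculus-class `θ` (slot discharged). The GLUED joint
verdict `¬ (C232S·C233T < |𝔡+𝔡′|²)` is `Repair.not_repairable_true_need_calc` (two-sided `𝔅`, K-S2) and is
not a member statement of this one-sided family. [cite: Zhang2022LandauSiegel, §2 (2.18), (2.32)–(2.33); §10 (10.1)] -/
theorem detShift_std_dLeg_verdict (hθ : AdmissibleThetaCalc θ) :
    ¬ ((frakc1T θ).re * C233T θ < ‖dSum1S θ‖ ^ 2) := by
  have h := not_repairable_detShift _ (inClass_dLeg ⟨signAdmissible_std, inShiftBox_std⟩ hθ) formDetPSD_shiftRecipe_std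
  rwa [dLeg, formDet_std_h1Profile hθ, formDet_std_tentT hθ, formDetPolar_std_dLeg] at h

/-- … and `𝔡′`-block: `¬ (C233T(θ.reflectJ) · Re 𝔠₂T(θ) < |𝔡′(θ)|²)`.
[cite: Zhang2022LandauSiegel, §2 (2.18), (2.32)–(2.33); §10 (10.1)] -/
theorem detShift_std_dPrimeLeg_verdict (hθ : AdmissibleThetaCalc θ) :
    ¬ (C233T θ.reflectJ * (frakc2T θ).re < ‖dSum2S θ‖ ^ 2) := by
  have h := not_repairable_detShift _ (inClass_dPrimeLeg ⟨signAdmissible_std, inShiftBox_std⟩ hθ) formDetPSD_shiftRecipe_std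
  rwa [dPrimeLeg, formDet_std_rtentT hθ, formDet_std_h2Profile hθ, formDetPolar_std_dPrimeLeg] at h

/-- **C4 (named members)**: at the printed design `θ₀` the `𝔡`- and `𝔡′`-block legs are members for the
three admissible shift boxes `(1;2,3)` (slot discharged), `bOffLattice`, `bNearLattice` (slot displayed —
numerical evidence only: kit j256305 / j256596 / j256588). [cite: Zhang2022LandauSiegel, §2 (2.13), (2.21)–(2.28)] -/
theorem inClass_legs_theta0 :
    (dLeg ![1, 2, 3] theta0).InClass ∧ (dPrimeLeg ![1, 2, 3] theta0).InClass ∧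
      (dLeg bOffLattice theta0).InClass ∧ (dPrimeLeg bOffLattice theta0).InClass ∧
      (dLeg bNearLattice theta0).InClass ∧ (dPrimeLeg bNearLattice theta0).InClass :=
  ⟨inClass_dLeg ⟨signAdmissible_std, inShiftBox_std⟩ admissible_theta0.toCalc,
    inClass_dPrimeLeg ⟨signAdmissible_std, inShiftBox_std⟩ admissible_theta0.toCalc,
    inClass_dLeg signAdmissible_bOffLattice admissible_theta0.toCalc,
    inClass_dPrimeLeg signAdmissible_bOffLattice admissible_theta0.toCalc,
    inClass_dLeg signAdmissible_bNearLattice admissible_theta0.toCalc,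
    inClass_dPrimeLeg signAdmissible_bNearLattice admissible_theta0.toCalc⟩

end Legs

end Repair

end Literature.NumberTheory.LFunctions.Zhang2022
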